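import Literature.NumberTheory.Sieve.FriedlanderIwaniecPrimesPoisson
import Mathlib.Analysis.SpecialFunctions.SmoothTransition
import Mathlib.Algebra.Order.Chebyshev
import HarnessLib

/-!
# Friedlander–Iwaniec, *The polynomial `X² + Y⁴` captures its primes*, §11: tools for Proposition 11.1 (duality, smooth majorant, Poisson)

Family `parity`, statement parity.S17 (`setOf_prime_sq_add_pow_four_infinite`). Source: J. Friedlander,
H. Iwaniec, Ann. of Math. (2) 148 (1998), 945–1040 [FriedlanderIwaniecAnnals1998], §11, proof of
Proposition 11.1, pp. 989–990: "By the duality principle familiar from the theory of the large sieve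
(see, for example, page 32 of [Bo2]) the estimate (11.14) is equivalent to (11.19)"; "First we
enlarge `W(D)` by attaching a smooth majorant `f(s)` such that `f(s) ≥ 0`, `f(s) ≥ 1` if
`S < s ≤ 2S`, `f̂(0) = 2S`, `f̂(t) ≪ S (1 + |t|S)⁻²`"; "By Poisson summation for the sum over `s` we
have the Fourier expansion `∑_{s ≡ ar (mod q)} f(s) = q⁻¹ ∑_h f̂(h/q) e(ahr/q)`".

Third file of the §§11–14 unit (after `…JacobiTwistedLemmas` = Lemmas 11.2–11.3 and
`…JacobiTwistedLemma114` = Lemma 11.4). It provides the three generic tools of the proof of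
Proposition 11.1; everything is PROVED (the only definitions are the explicit bump and majorant):

* **`duality_principle`** — for a finite matrix `M_{ij}` of complex numbers: if
  `∑_j |∑_i M_{ij} x_i|² ≤ Δ ‖x‖²` for all `x` then `∑_i |∑_j M_{ij} y_j|² ≤ Δ ‖y‖²` for all `y`
  (`norm_sum_mul_sq_le` is the Cauchy–Schwarz step);
* `jtBump` — the smooth bump `g(u) = ψ(2u−1)ψ(5−2u)` (`ψ = Real.smoothTransition`): `0 ≤ g ≤ 1`,
  `g = 1` on `[1, 2]`, `g = 0` off `(1/2, 5/2)`, smooth, compactly supported (`jtBumpC` its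
  complexification), with the Fourier decay `exists_norm_fourier_jtBumpC_le`:
  `|𝓕g(ξ)| ≤ C (1 + ξ²)⁻¹` (two partial integrations, `pow_mul_norm_fourier_le` of
  `FriedlanderIwaniecPrimesPoisson`);
* `jtMajorant S = g(·/S)` — FI's majorant `f` of `(S, 2S]` (normalised by `f̂(0) = ĝ(0) S` rather
  than `2S`, immaterial): `jtMajorant_eq_one` on `[S, 2S]`, `jtMajorant_eq_zero` off `(S/2, 5S/2)`,
  `0 ≤ f ≤ 1`, `fourier_jtMajorantC` (`f̂(t) = S ĝ(St)`), **`norm_fourier_jtMajorantC_le`**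
  (`|f̂(t)| ≤ C S (1 + (St)²)⁻¹`);
* **`tsum_jtMajorantC_arithProg`** — `∑_{m ∈ ℤ} f(c + qm) = q⁻¹ ∑_{k ∈ ℤ} e(ck/q) f̂(k/q)`
  (`tsum_arithProg_eq_tsum_fourier` of the tree), and `tsum_jtMajorantC_arithProg_eq_sum` — the
  left side is the finite sum `∑_{0 ≤ s < 3S, s ≡ c (q)} f(s)` for natural `S ≥ 1`.

## References

* J. Friedlander, H. Iwaniec, Ann. of Math. (2) 148 (1998), 945–1040, §11, (11.18)–(11.22).
  [FriedlanderIwaniecAnnals1998]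
* E. Bombieri, *Le grand crible dans la théorie analytique des nombres*, Astérisque 18 (1987),
  p. 32 (the duality principle).

## Tree / Mathlib

Tree: `fourier_comp_affine`, `tsum_arithProg_eq_tsum_fourier`, `norm_fourier_le_integral_norm`,
`norm_fourier_le_div` (`FriedlanderIwaniecPrimesPoisson`). Mathlib: `Real.smoothTransition` (and its
`contDiff`, `nonneg`, `le_one`, `zero_of_nonpos`, `one_of_one_le`), `HasCompactSupport.intro`,
`Finset.sum_mul_sq_le_sq_mul_sq`, `Complex.normSq_eq_conj_mul_self`, `tsum_eq_sum`,
`Finset.sum_nbij'`.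
-/

noncomputable section

open Finset Real Complex MeasureTheory
open scoped FourierTransform ContDiff ComplexConjugate

namespace Literature.NumberTheory.Sieve.FriedlanderIwaniecPrimes

/-! ### The duality principle for bilinear forms -/

/-- Cauchy–Schwarz for finite sums of complex numbers, in norm form:
`‖∑ a_j b_j‖² ≤ (∑ ‖a_j‖²)(∑ ‖b_j‖²)`. [folklore] -/
theorem norm_sum_mul_sq_le {κ : Type*} (t : Finset κ) (a b : κ → ℂ) :
    ‖∑ j ∈ t, a j * b j‖ ^ 2 ≤ (∑ j ∈ t, ‖a j‖ ^ 2) * (∑ j ∈ t, ‖b j‖ ^ 2) := by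
  calc ‖∑ j ∈ t, a j * b j‖ ^ 2 ≤ (∑ j ∈ t, ‖a j‖ * ‖b j‖) ^ 2 := by
        refine pow_le_pow_left₀ (norm_nonneg _) ((norm_sum_le _ _).trans (le_of_eq ?_)) 2
        exact sum_congr rfl fun j _ => norm_mul _ _
    _ ≤ (∑ j ∈ t, ‖a j‖ ^ 2) * (∑ j ∈ t, ‖b j‖ ^ 2) := sum_mul_sq_le_sq_mul_sq t _ _

/-- **The duality principle** ("familiar from the theory of the large sieve", Bombieri, *Le grand
crible*, p. 32): if `∑_j |∑_i M_{ij} x_i|² ≤ Δ ‖x‖²` for all `x`, then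
`∑_i |∑_j M_{ij} y_j|² ≤ Δ ‖y‖²` for all `y`. [cite: FriedlanderIwaniecAnnals1998, §11, (11.18)-(11.19)] -/
theorem duality_principle {ι κ : Type*} (s : Finset ι) (t : Finset κ) (M : ι → κ → ℂ) {Δ : ℝ}
    (hΔ : 0 ≤ Δ)
    (h : ∀ x : ι → ℂ, ∑ j ∈ t, ‖∑ i ∈ s, M i j * x i‖ ^ 2 ≤ Δ * ∑ i ∈ s, ‖x i‖ ^ 2)
    (y : κ → ℂ) :
    ∑ i ∈ s, ‖∑ j ∈ t, M i j * y j‖ ^ 2 ≤ Δ * ∑ j ∈ t, ‖y j‖ ^ 2 := by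
  set T : ι → ℂ := fun i => ∑ j ∈ t, M i j * y j with hT
  set Φ : ℝ := ∑ i ∈ s, ‖T i‖ ^ 2 with hΦ
  have hΦ0 : 0 ≤ Φ := sum_nonneg fun _ _ => by positivity
  have hY0 : 0 ≤ ∑ j ∈ t, ‖y j‖ ^ 2 := sum_nonneg fun _ _ => by positivity
  -- `Φ = ∑_j y_j (∑_i M_{ij} conj(T_i))`
  have hexp : (Φ : ℂ) = ∑ j ∈ t, y j * ∑ i ∈ s, M i j * conj (T i) := by
    calc (Φ : ℂ) = ∑ i ∈ s, conj (T i) * T i := by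
          rw [hΦ]; push_cast
          refine sum_congr rfl fun i _ => ?_
          rw [← Complex.ofReal_pow, ← Complex.normSq_eq_norm_sq, Complex.normSq_eq_conj_mul_self]
      _ = ∑ i ∈ s, ∑ j ∈ t, conj (T i) * (M i j * y j) := by
          refine sum_congr rfl fun i _ => ?_
          rw [hT, mul_sum]
      _ = ∑ j ∈ t, ∑ i ∈ s, conj (T i) * (M i j * y j) := sum_comm
      _ = ∑ j ∈ t, y j * ∑ i ∈ s, M i j * conj (T i) := by
          refine sum_congr rfl fun j _ => ?_
          rw [mul_sum]
          exact sum_congr rfl fun i _ => by ring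
  -- Cauchy–Schwarz and the hypothesis applied to `x = conj ∘ T`
  have hdual := h (fun i => conj (T i))
  have hnormT : ∑ i ∈ s, ‖conj (T i)‖ ^ 2 = Φ := by
    rw [hΦ]; exact sum_congr rfl fun i _ => by rw [Complex.norm_conj]
  rw [hnormT] at hdual
  have hCS := norm_sum_mul_sq_le t y (fun j => ∑ i ∈ s, M i j * conj (T i))
  rw [← hexp, Complex.norm_real, Real.norm_eq_abs, abs_of_nonneg hΦ0] at hCS
  -- `Φ² ≤ ‖y‖² Δ Φ`
  have h2 : Φ ^ 2 ≤ (∑ j ∈ t, ‖y j‖ ^ 2) * (Δ * Φ) :=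
    hCS.trans (mul_le_mul_of_nonneg_left hdual hY0)
  -- conclude
  show Φ ≤ Δ * ∑ j ∈ t, ‖y j‖ ^ 2
  by_cases hΦpos : Φ = 0
  · rw [hΦpos]; positivity
  · have hΦpos' : 0 < Φ := lt_of_le_of_ne hΦ0 (Ne.symm hΦpos)
    nlinarith


/-! ### A smooth bump equal to `1` on `[1, 2]` -/

/-- The bump `g(u) = ψ(2u - 1) ψ(5 - 2u)`, `ψ = Real.smoothTransition`: smooth, `0 ≤ g ≤ 1`,
`g = 1` on `[1, 2]`, `g = 0` off `(1/2, 5/2)`. [folklore] -/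
def jtBump (u : ℝ) : ℝ := Real.smoothTransition (2 * u - 1) * Real.smoothTransition (5 - 2 * u)

/-- Unfolding `jtBump`. [folklore] -/
theorem jtBump_def (u : ℝ) :
    jtBump u = Real.smoothTransition (2 * u - 1) * Real.smoothTransition (5 - 2 * u) := rfl

/-- `g ≥ 0`. [folklore] -/
theorem jtBump_nonneg (u : ℝ) : 0 ≤ jtBump u :=
  mul_nonneg (Real.smoothTransition.nonneg _) (Real.smoothTransition.nonneg _)

/-- `g ≤ 1`. [folklore] -/
theorem jtBump_le_one (u : ℝ) : jtBump u ≤ 1 :=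
  mul_le_one₀ (Real.smoothTransition.le_one _) (Real.smoothTransition.nonneg _)
    (Real.smoothTransition.le_one _)

/-- `g = 1` on `[1, 2]`. [folklore] -/
theorem jtBump_eq_one {u : ℝ} (h1 : 1 ≤ u) (h2 : u ≤ 2) : jtBump u = 1 := by
  rw [jtBump_def, Real.smoothTransition.one_of_one_le (by linarith),
    Real.smoothTransition.one_of_one_le (by linarith), one_mul]

/-- `g = 0` off `(1/2, 5/2)`. [folklore] -/
theorem jtBump_eq_zero {u : ℝ} (h : u ≤ 1 / 2 ∨ 5 / 2 ≤ u) : jtBump u = 0 := by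
  rcases h with h | h
  · rw [jtBump_def, Real.smoothTransition.zero_of_nonpos (by linarith), zero_mul]
  · rw [jtBump_def, Real.smoothTransition.zero_of_nonpos (x := 5 - 2 * u) (by linarith), mul_zero]

/-- `g` is smooth. [folklore] -/
theorem contDiff_jtBump : ContDiff ℝ ∞ jtBump := by
  refine ContDiff.mul ?_ ?_
  · exact Real.smoothTransition.contDiff.comp
      ((contDiff_const.mul contDiff_id).sub contDiff_const)
  · exact Real.smoothTransition.contDiff.comp
      (contDiff_const.sub (contDiff_const.mul contDiff_id))

/-- `g` is continuous. [folklore] -/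
theorem continuous_jtBump : Continuous jtBump := contDiff_jtBump.continuous

/-- The complexified bump. [folklore] -/
def jtBumpC (u : ℝ) : ℂ := (jtBump u : ℂ)

/-- Unfolding `jtBumpC`. [folklore] -/
theorem jtBumpC_apply (u : ℝ) : jtBumpC u = (jtBump u : ℂ) := rfl

/-- `g` (complexified) is smooth. [folklore] -/
theorem contDiff_jtBumpC : ContDiff ℝ ∞ jtBumpC :=
  Complex.ofRealCLM.contDiff.comp contDiff_jtBump

/-- `|g| ≤ 1`. [folklore] -/
theorem norm_jtBumpC_le_one (u : ℝ) : ‖jtBumpC u‖ ≤ 1 := by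
  rw [jtBumpC_apply, Complex.norm_real, Real.norm_eq_abs, abs_of_nonneg (jtBump_nonneg u)]
  exact jtBump_le_one u

/-- `g` has compact support (in `[1/2, 5/2]`). [folklore] -/
theorem hasCompactSupport_jtBumpC : HasCompactSupport jtBumpC := by
  refine HasCompactSupport.intro (isCompact_Icc (a := (1 / 2 : ℝ)) (b := 5 / 2)) fun u hu => ?_
  rw [Set.mem_Icc, not_and_or, not_le, not_le] at hu
  rw [jtBumpC_apply, jtBump_eq_zero (by rcases hu with h | h <;> [left; right] <;> linarith),
    Complex.ofReal_zero]

/-- **Fourier decay of the bump**: `|𝓕g(ξ)| ≤ C (1 + ξ²)⁻¹` (two partial integrations,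
`pow_mul_norm_fourier_le`). [folklore] -/
theorem exists_norm_fourier_jtBumpC_le :
    ∃ C : ℝ, 0 < C ∧ ∀ ξ : ℝ, ‖𝓕 jtBumpC ξ‖ ≤ C / (1 + ξ ^ 2) := by
  set I₀ : ℝ := ∫ t, ‖jtBumpC t‖ with hI₀
  set I₂ : ℝ := ∫ t, ‖iteratedDeriv 2 jtBumpC t‖ with hI₂
  have hI₀0 : 0 ≤ I₀ := integral_nonneg fun _ => norm_nonneg _
  have hI₂0 : 0 ≤ I₂ := integral_nonneg fun _ => norm_nonneg _
  refine ⟨2 * (I₀ + I₂) + 1, by positivity, fun ξ => ?_⟩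
  have h0 : ‖𝓕 jtBumpC ξ‖ ≤ I₀ := norm_fourier_le_integral_norm jtBumpC ξ
  rw [le_div_iff₀ (by positivity)]
  rcases le_or_gt |ξ| 1 with hξ | hξ
  · have hξ2 : ξ ^ 2 ≤ 1 := by
      rw [← sq_abs]; exact pow_le_one₀ (abs_nonneg ξ) hξ
    nlinarith [norm_nonneg (𝓕 jtBumpC ξ)]
  · have hξ0 : ξ ≠ 0 := fun h => by rw [h, abs_zero] at hξ; linarith
    have h2 := norm_fourier_le_div contDiff_jtBumpC hasCompactSupport_jtBumpC 2 hξ0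
    have hden : ξ ^ 2 ≤ (2 * π * |ξ|) ^ 2 := by
      rw [mul_pow, ← sq_abs ξ]
      have : (1 : ℝ) ≤ (2 * π) ^ 2 := by nlinarith [Real.two_le_pi]
      nlinarith [sq_nonneg |ξ|]
    have hξ2 : 1 ≤ ξ ^ 2 := by
      rw [← sq_abs]; exact one_le_pow₀ hξ.le
    have h3 : ‖𝓕 jtBumpC ξ‖ * ξ ^ 2 ≤ I₂ := by
      calc ‖𝓕 jtBumpC ξ‖ * ξ ^ 2 ≤ I₂ / (2 * π * |ξ|) ^ 2 * (2 * π * |ξ|) ^ 2 :=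
            mul_le_mul h2 hden (by positivity) (by positivity)
        _ = I₂ := div_mul_cancel₀ _ (by positivity)
    nlinarith [norm_nonneg (𝓕 jtBumpC ξ)]

/-! ### The smooth majorant `f(u) = g(u/S)` of the dyadic segment `S < s ≤ 2S` -/

/-- FI's smooth majorant `f` of `(S, 2S]` ("we enlarge `W(D)` by attaching a smooth majorant `f(s)`
such that `f(s) ≥ 0`, `f(s) ≥ 1` if `S < s ≤ 2S`, `f̂(0) = 2S`, `f̂(t) ≪ S(1 + |t|S)⁻²`"; here
`f = g(·/S)`, so `f̂(t) = S ĝ(St)` and `f̂(0) = ĝ(0) S`). [cite: FriedlanderIwaniecAnnals1998, §11, before (11.20)] -/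
def jtMajorant (S : ℝ) (u : ℝ) : ℝ := jtBump (u / S)

/-- The complexified majorant. [folklore] -/
def jtMajorantC (S : ℝ) (u : ℝ) : ℂ := (jtMajorant S u : ℂ)

/-- Unfolding `jtMajorant`. [folklore] -/
theorem jtMajorant_def (S u : ℝ) : jtMajorant S u = jtBump (u / S) := rfl

/-- Unfolding `jtMajorantC`. [folklore] -/
theorem jtMajorantC_apply (S u : ℝ) : jtMajorantC S u = (jtMajorant S u : ℂ) := rfl

/-- `f = g(0 + S⁻¹ ·)` (the affine form used for the Fourier transform). [folklore] -/
theorem jtMajorantC_eq_comp (S : ℝ) : jtMajorantC S = fun u => jtBumpC (0 + S⁻¹ * u) := by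
  funext u; rw [jtMajorantC_apply, jtMajorant_def, jtBumpC_apply, zero_add, inv_mul_eq_div]

/-- `f ≥ 0`. [folklore] -/
theorem jtMajorant_nonneg (S u : ℝ) : 0 ≤ jtMajorant S u := jtBump_nonneg _

/-- `f ≤ 1`. [folklore] -/
theorem jtMajorant_le_one (S u : ℝ) : jtMajorant S u ≤ 1 := jtBump_le_one _

/-- `f = 1` on `[S, 2S]`. [folklore] -/
theorem jtMajorant_eq_one {S u : ℝ} (hS : 0 < S) (h1 : S ≤ u) (h2 : u ≤ 2 * S) :
    jtMajorant S u = 1 :=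
  jtBump_eq_one ((one_le_div hS).mpr h1) ((div_le_iff₀ hS).mpr (by linarith))

/-- `f = 0` off `(S/2, 5S/2)`. [folklore] -/
theorem jtMajorant_eq_zero {S u : ℝ} (hS : 0 < S) (h : u ≤ S / 2 ∨ 5 * S / 2 ≤ u) :
    jtMajorant S u = 0 := by
  refine jtBump_eq_zero ?_
  rcases h with h | h
  · left; rw [div_le_iff₀ hS]; linarith
  · right; rw [le_div_iff₀ hS]; linarith

/-- `f` is smooth. [folklore] -/
theorem contDiff_jtMajorantC (S : ℝ) : ContDiff ℝ ∞ (jtMajorantC S) := by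
  rw [jtMajorantC_eq_comp]
  exact contDiff_jtBumpC.comp (contDiff_const.add (contDiff_const.mul contDiff_id))

/-- `f` has compact support (in `[S/2, 5S/2]`), `S > 0`. [folklore] -/
theorem hasCompactSupport_jtMajorantC {S : ℝ} (hS : 0 < S) : HasCompactSupport (jtMajorantC S) := by
  refine HasCompactSupport.intro (isCompact_Icc (a := S / 2) (b := 5 * S / 2)) fun u hu => ?_
  rw [Set.mem_Icc, not_and_or, not_le, not_le] at hu
  rw [jtMajorantC_apply, jtMajorant_eq_zero hS (by rcases hu with h | h <;> [left; right] <;> linarith),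
    Complex.ofReal_zero]

/-- `|f| ≤ 1`. [folklore] -/
theorem norm_jtMajorantC_le_one (S u : ℝ) : ‖jtMajorantC S u‖ ≤ 1 := by
  rw [jtMajorantC_apply, Complex.norm_real, Real.norm_eq_abs, abs_of_nonneg (jtMajorant_nonneg S u)]
  exact jtMajorant_le_one S u

/-- **`f̂(t) = S ĝ(St)`.** [folklore] -/
theorem fourier_jtMajorantC {S : ℝ} (hS : 0 < S) (ξ : ℝ) :
    𝓕 (jtMajorantC S) ξ = (S : ℂ) * 𝓕 jtBumpC (S * ξ) := by
  rw [jtMajorantC_eq_comp, fourier_comp_affine jtBumpC (inv_pos.mpr hS) 0 ξ]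
  simp [div_inv_eq_mul, mul_comm ξ S]

/-- **`|f̂(t)| ≤ C S (1 + (St)²)⁻¹`** ("`f̂(t) ≪ S (1 + |t|S)⁻²`"), with the constant of
`exists_norm_fourier_jtBumpC_le`. [cite: FriedlanderIwaniecAnnals1998, §11, before (11.20)] -/
theorem norm_fourier_jtMajorantC_le {C : ℝ} (hC : ∀ ξ : ℝ, ‖𝓕 jtBumpC ξ‖ ≤ C / (1 + ξ ^ 2))
    {S : ℝ} (hS : 0 < S) (ξ : ℝ) :
    ‖𝓕 (jtMajorantC S) ξ‖ ≤ C * S / (1 + (S * ξ) ^ 2) := by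
  rw [fourier_jtMajorantC hS, norm_mul, Complex.norm_real, Real.norm_eq_abs, abs_of_pos hS,
    mul_comm C S, mul_div_assoc]
  exact mul_le_mul_of_nonneg_left (hC _) hS.le

/-! ### Poisson summation for the majorant along an arithmetic progression -/

/-- **`F_q(c) = ∑_{s ≡ c (q)} f(s) = q⁻¹ ∑_h e(ch/q) f̂(h/q)`** (Poisson summation along the
progression; "By Poisson summation for the sum over `s` we have the Fourier expansion
`∑_{s ≡ ar (q)} f(s) = q⁻¹ ∑_h f̂(h/q) e(ahr/q)`"). [cite: FriedlanderIwaniecAnnals1998, §11, proof of (11.22)] -/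
theorem tsum_jtMajorantC_arithProg {S : ℝ} (hS : 0 < S) {q : ℕ} (hq : 0 < q) (c : ℤ) :
    ∑' m : ℤ, jtMajorantC S (c + q * m) =
      (q : ℂ)⁻¹ * ∑' k : ℤ, (𝐞 ((c : ℝ) * k / q) : ℂ) * 𝓕 (jtMajorantC S) ((k : ℝ) / q) :=
  tsum_arithProg_eq_tsum_fourier (contDiff_jtMajorantC S) (hasCompactSupport_jtMajorantC hS) hq c


/-! ### The progression sums `F_q(c)` as finite sums -/

/-- The integers `s` with `f(s) ≠ 0` satisfy `0 < s < 3S`. [folklore] -/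
theorem jtMajorant_intCast_eq_zero {S : ℕ} (hS : 0 < S) {s : ℤ} (h : s ≤ 0 ∨ (3 * S : ℤ) ≤ s) :
    jtMajorant S (s : ℝ) = 0 := by
  have hSr : (0 : ℝ) < S := by exact_mod_cast hS
  refine jtMajorant_eq_zero hSr ?_
  rcases h with h | h
  · left
    have : (s : ℝ) ≤ 0 := by exact_mod_cast h
    linarith
  · right
    have : (3 * S : ℝ) ≤ s := by exact_mod_cast h
    linarith

/-- **`F_q(c)` is a finite sum:** for `S, q ≥ 1` and any `c`,
`∑_{m ∈ ℤ} f(c + qm) = ∑_{0 ≤ s < 3S, s ≡ c (q)} f(s)`. [folklore] -/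
theorem tsum_jtMajorantC_arithProg_eq_sum {S : ℕ} (hS : 0 < S) {q : ℕ} (hq : 0 < q) (c : ℤ) :
    ∑' m : ℤ, jtMajorantC S (c + q * m) =
      ∑ s ∈ (range (3 * S)).filter (fun s : ℕ => (q : ℤ) ∣ (s : ℤ) - c), (jtMajorant S s : ℂ) := by
  have hqz : (0 : ℤ) < q := by exact_mod_cast hq
  -- the finite set of relevant `m`
  set M : Finset ℤ := ((range (3 * S)).filter (fun s : ℕ => (q : ℤ) ∣ (s : ℤ) - c)).image
    (fun s : ℕ => ((s : ℤ) - c) / q) with hM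
  have hzero : ∀ m ∉ M, jtMajorantC S (c + q * m) = 0 := by
    intro m hm
    have h : (c + q * m ≤ 0) ∨ ((3 * S : ℤ) ≤ c + q * m) := by
      by_contra hcon
      push Not at hcon
      apply hm
      rw [hM, mem_image]
      refine ⟨(c + q * m).toNat, ?_, ?_⟩
      · rw [mem_filter, mem_range]
        refine ⟨by omega, ?_⟩
        rw [Int.toNat_of_nonneg (by omega)]
        exact ⟨m, by ring⟩
      · rw [Int.toNat_of_nonneg (by omega)]
        rw [show c + (q : ℤ) * m - c = q * m by ring, Int.mul_ediv_cancel_left _ hqz.ne']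
    rw [jtMajorantC_apply]
    have := jtMajorant_intCast_eq_zero hS h
    push_cast at this
    rw [this, Complex.ofReal_zero]
  rw [tsum_eq_sum (s := M) hzero]
  -- reindex `m ↦ s = c + qm`
  symm
  refine sum_nbij' (fun s : ℕ => ((s : ℤ) - c) / q) (fun m : ℤ => (c + q * m).toNat) ?_ ?_ ?_ ?_ ?_
  · intro s hs
    rw [hM]; exact mem_image_of_mem _ hs
  · intro m hm
    rw [hM, mem_image] at hm
    obtain ⟨s, hs, rfl⟩ := hm
    rw [mem_filter] at hs
    obtain ⟨k, hk⟩ := hs.2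
    have : c + (q : ℤ) * (((s : ℤ) - c) / q) = s := by
      rw [hk, Int.mul_ediv_cancel_left _ hqz.ne']; omega
    rw [this, Int.toNat_natCast]
    exact mem_filter.mpr hs
  · intro s hs
    rw [mem_filter] at hs
    obtain ⟨k, hk⟩ := hs.2
    show (c + (q : ℤ) * (((s : ℤ) - c) / q)).toNat = s
    rw [hk, Int.mul_ediv_cancel_left _ hqz.ne', show c + (q : ℤ) * k = s by omega, Int.toNat_natCast]
  · intro m hm
    rw [hM, mem_image] at hm
    obtain ⟨s, hs, rfl⟩ := hm
    rw [mem_filter] at hs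
    obtain ⟨k, hk⟩ := hs.2
    show (((c + (q : ℤ) * (((s : ℤ) - c) / q)).toNat : ℕ) - c : ℤ) / q = ((s : ℤ) - c) / q
    have : c + (q : ℤ) * (((s : ℤ) - c) / q) = s := by
      rw [hk, Int.mul_ediv_cancel_left _ hqz.ne']; omega
    rw [this, Int.toNat_natCast]
  · intro s hs
    rw [mem_filter] at hs
    obtain ⟨k, hk⟩ := hs.2
    rw [jtMajorantC_apply]
    congr 1
    congr 1
    have : (c : ℝ) + (q : ℝ) * ((((s : ℤ) - c) / q : ℤ) : ℝ) = s := by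
      rw [hk, Int.mul_ediv_cancel_left _ hqz.ne']
      have : (s : ℤ) = c + q * k := by omega
      have h' : (s : ℝ) = ((c + q * k : ℤ) : ℝ) := by exact_mod_cast this
      rw [h']; push_cast; ring
    exact this.symm


end Literature.NumberTheory.Sieve.FriedlanderIwaniecPrimes
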